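import Summits.BirchSwinnertonDyer.BirchSwinnertonDyer.Theorems.GenusKolyvaginAtTwoGenusPrimitiveSupplyAtTwoPrimeTwistInertBridge
import Literature.NumberTheory.EllipticCurves.PrimeTwistLocalConditionSplitPlace
import HarnessLib

/-!
# Route `GenusKolyvaginAtTwo`, crux #2 `GenusPrimitiveSupplyAtTwo` (stmt-BirchSwinnertonDyer-22136):
# THE INERT BRICK of the prime-twist dictionary — at a place of GOOD reduction where the quadratic character `χ` is UNRAMIFIED and
# NON-TRIVIAL (`K_v(ι√d)/K_v` the unramified quadratic extension), `PrimeTwist.selmerLocalKer W χ K_v = W.selmerLocalKer K_v 2`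

Width seat `bsd-line-gk2-p5` g14 (cell `bsd-f1-sign2`, SUPPLY lineage of crux 22136), file 32 of the series; sequel of file 31 (`…PrimeTwistInertBridge`:
`H¹(Gal(K'/K_v), E(K')) = 0` in `localPoints` currency) and file 38 (`…TwistUnramifiedGoodNorm`: Mazur's norm theorem `hnorm`). THEOREMS ONLY (no
definition, no named fact, no `sorry`); helper `--supports stmt-BirchSwinnertonDyer-22136`; no item is closed; BSD is not proved by any of this.

WHAT (Mazur–Rubin 2010 Lemma 2.10 (v) / 2007 §5 in PRIME-TWIST currency, `p = 2`). `W/K` elliptic over a number field, `v` a finite place of good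
reduction, `d ∈ K` with `α = ι√d ∈ K̄_v` unramified (`α ∈ K_v^{nr}`) and `d ∉ K_v²`, `χ : Γ_K → {±1}` a character whose restriction to `Γ_{K_v}` cuts
out `K_v(α)` (`hχα : χ (resGal τ) = 1 ↔ τ α = α`; for `K = ℚ` and `χ = χ_d` this is `IsQuadraticCharacterOf`, file 33). Then inside `H¹(K, E[2])`:

* §132 `le_primeTwist_selmerLocalKer_of_inert` — **`H¹_f(K_v) ≤ H¹_𝒜(K_v)`**: a class `c` with `c|_{Γ_v} = ∂Q` in `E(K̄_v)` bounds in `A_χ(K̄_v)` by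
  `f = (Q + S, −Q − S)` where `S + τ₀S = −2Q` with `S ∈ E(K_v(α))` — Mazur's NORM theorem (file 38 `hnorm`; `2Q ∈ E(K_v)` because `c` is
  `2`-torsion-valued; `τ₀` the flip of `α`).
* §133 `primeTwist_selmerLocalKer_le_of_inert` — **`H¹_𝒜(K_v) ≤ H¹_f(K_v)`**: `c|_{Γ_v} = ∂f` in `A_χ`, `f = (R, −R)`, gives `c(τ) = τR − R` on the
  stabiliser of `α` and `c(τ) = −τR − R` off it; then `T = 2R ∈ E(K_v(α))` has `T + τ₀T = O`, so `T = τ₀S − S` (file 31 `hanti`, Kramer–Tunnell's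
  `H¹ = 0`), and `c|_{Γ_v} = ∂(R + S)` in `E(K̄_v)`.
* §134 **`primeTwist_selmerLocalKer_eq_of_inert`** — the equality.

Honest framing: KNOWN in print (MR 2007 §5 / MR 2010 Lemma 2.10 (v): `H¹_𝒜 = H¹_f = H¹_ur` at a good prime unramified in `L/K`; Mazur 1972 Cor. 4.4;
Kramer–Tunnell 1982 Lemma 6.1); kernel-new; beyond-print theorem: no. Crux 22136 stays OPEN at (U) 24947 ∧ (CONV₂) 19220/24948. BSD is not proved.

References: [MazurRubin2007] Def 4.3, §5; [MazurRubin2010] Lemma 2.9, Lemma 2.10 (v); [Mazur1972] Cor. 4.4; [KramerTunnell1982] §6 Lemma 6.1.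
-/

set_option linter.dupNamespace false -- tree convention: `Summit.BirchSwinnertonDyer.BirchSwinnertonDyer.Theorems` (summit = sub-problem)
set_option autoImplicit false

noncomputable section

open scoped Classical

namespace Summit.BirchSwinnertonDyer.BirchSwinnertonDyer.Theorems.GenusKolyArch

open WeierstrassCurve Field NumberField IsDedekindDomain Function
open Literature.NumberTheory.EllipticCurves Literature.NumberTheory.GaloisRepresentations
open Literature.NumberTheory.GaloisRepresentations.IsNonarchimedeanLocalField (maxUnramified)
open Literature.NumberTheory.EllipticCurves.PrimeTwist (ResPoints points localChar localModule locMap constEmb mem_points_iff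
  coe_locMap_constEmb_apply)

section Inert

variable {K : Type} [Field K] [NumberField K] (W : WeierstrassCurve K) (v : HeightOneSpectrum (𝓞 K)) {d : K}
variable (χ : absoluteGaloisGroup K →ₜ* Multiplicative (ZMod 2))

omit [NumberField K] in
/-- **The exponent of the local character is `0` on the stabiliser of `α` and `1` off it** (a `ZMod 2`-valued character vanishes exactly where it
is trivial). [cite: MazurRubin2007, §5] -/
theorem expo_localChar_eq_of_iff {E : Type} [Field E] [Algebra K E]
    {α : AlgebraicClosure E} (hχα : ∀ τ : absoluteGaloisGroup E,
      χ (resGal (K := K) E τ) = 1 ↔ (show AlgebraicClosure E ≃ₐ[E] AlgebraicClosure E from τ) α = α) (τ : absoluteGaloisGroup E) :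
    (((show AlgebraicClosure E ≃ₐ[E] AlgebraicClosure E from τ) α = α) → ResPoints.expo (localChar χ E) τ = 0) ∧
      (((show AlgebraicClosure E ≃ₐ[E] AlgebraicClosure E from τ) α ≠ α) → ResPoints.expo (localChar χ E) τ = 1) := by
  have h01 : ∀ z : ZMod 2, z = 0 ∨ z = 1 := by decide
  have hdef : ResPoints.expo (localChar χ E) τ =
      Multiplicative.toAdd ((χ : absoluteGaloisGroup K →* Multiplicative (ZMod 2)) (resGal (K := K) E τ)) := rfl
  have hcoe : (χ : absoluteGaloisGroup K →* Multiplicative (ZMod 2)) (resGal (K := K) E τ) = χ (resGal (K := K) E τ) := rfl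
  refine ⟨fun hfix ↦ ?_, fun hmove ↦ ?_⟩
  · rw [hdef, hcoe, (hχα τ).mpr hfix]
    rfl
  · rcases h01 (ResPoints.expo (localChar χ E) τ) with h0 | h1
    · exfalso
      apply hmove
      apply (hχα τ).mp
      rw [hdef, hcoe] at h0
      exact Multiplicative.toAdd.injective (h0.trans toAdd_one.symm)
    · exact h1

/-- **THE INERT COMPARISON, inclusion `H¹_f(K_v) ≤ H¹_𝒜(K_v)`** — `W` good at `v`, `α = ι√d` unramified and `∉ K_v`, `χ|_{Γ_{K_v}}` the character of
`K_v(α)/K_v`: a class of `H¹(K, E[2])` in `E`'s Kummer local condition at `K_v` lies in the `𝔓`-Selmer local condition of `A_χ` at `K_v`.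
If `c|_{Γ_v} = ∂Q` in `E(K̄_v)`, then `2Q ∈ E(K_v)` and (Mazur's norm theorem) `−2Q = S + τ₀S` with `S ∈ E(K_v(α))`; the pair
`f = (Q + S, −(Q + S)) ∈ A_χ(K̄_v)` bounds `c` for the twisted action `(τ⋆f)_i = τ f_{i−χ(τ)}`. [cite: MazurRubin2010, Lemma 2.9 and Lemma 2.10 (v)]
[cite: MazurRubin2007, Def 4.3 and §5] -/
theorem le_primeTwist_selmerLocalKer_of_inert (hv : W.HasGoodReductionAt v)
    (hα : closureEmb (K := K) (v.adicCompletion K) (geomSqrt d) ∈ maxUnramified (v.adicCompletion K))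
    (hd : ∀ s : v.adicCompletion K, s ^ 2 ≠ algebraMap K (v.adicCompletion K) d)
    (hχα : ∀ τ : absoluteGaloisGroup (v.adicCompletion K), χ (resGal (K := K) (v.adicCompletion K) τ) = 1 ↔
      (show AlgebraicClosure (v.adicCompletion K) ≃ₐ[v.adicCompletion K] AlgebraicClosure (v.adicCompletion K) from τ)
        (closureEmb (K := K) (v.adicCompletion K) (geomSqrt d)) = closureEmb (K := K) (v.adicCompletion K) (geomSqrt d)) :
    W.selmerLocalKer (v.adicCompletion K) 2 ≤ PrimeTwist.selmerLocalKer W χ (v.adicCompletion K) := by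
  set E := v.adicCompletion K with hEdef
  set α := closureEmb (K := K) E (geomSqrt d) with hαdef
  obtain ⟨τ₀, hτ₀⟩ := exists_flip_closureEmb_geomSqrt v hd
  have hnorm := forall_exists_norm_of_hasGoodReductionAt_of_mem_maxUnramified W v hv hα hd hτ₀
  -- `τ α = ± α`, hence the two cases of the twisted action
  have hsq : ∀ τ : absoluteGaloisGroup E,
      (show AlgebraicClosure E ≃ₐ[E] AlgebraicClosure E from τ) α = α ∨
        (show AlgebraicClosure E ≃ₐ[E] AlgebraicClosure E from τ) α = -α := fun τ ↦ by
    have h2 : ((show AlgebraicClosure E ≃ₐ[E] AlgebraicClosure E from τ) α) ^ 2 = α ^ 2 := by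
      rw [← map_pow, hαdef, closureEmb_geomSqrt_sq_eq_algebraMap v, AlgEquiv.commutes]
    exact sq_eq_sq_iff_eq_or_eq_neg.mp h2
  -- two flips agree on the points fixed by the stabiliser of `α`
  have hflip : ∀ τ : absoluteGaloisGroup E, (show AlgebraicClosure E ≃ₐ[E] AlgebraicClosure E from τ) α = -α →
      ∀ S : localPoints W E, (∀ g : absoluteGaloisGroup E,
        (show AlgebraicClosure E ≃ₐ[E] AlgebraicClosure E from g) α = α → g • S = S) → τ • S = τ₀ • S := by
    intro τ hτ S hS
    have hg : (show AlgebraicClosure E ≃ₐ[E] AlgebraicClosure E from τ₀⁻¹ * τ) α = α := by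
      change (show AlgebraicClosure E ≃ₐ[E] AlgebraicClosure E from τ₀⁻¹)
        ((show AlgebraicClosure E ≃ₐ[E] AlgebraicClosure E from τ) α) = α
      rw [hτ, map_neg]
      have h0 : (show AlgebraicClosure E ≃ₐ[E] AlgebraicClosure E from τ₀⁻¹)
          ((show AlgebraicClosure E ≃ₐ[E] AlgebraicClosure E from τ₀) α) = α := by
        change (show AlgebraicClosure E ≃ₐ[E] AlgebraicClosure E from τ₀⁻¹ * τ₀) α = α
        rw [inv_mul_cancel]; rfl
      rw [hτ₀, map_neg] at h0
      rw [← neg_eq_iff_eq_neg.mpr h0.symm, neg_neg]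
    have h := hS (τ₀⁻¹ * τ) hg
    calc τ • S = (τ₀ * (τ₀⁻¹ * τ)) • S := by rw [mul_inv_cancel_left]
      _ = τ₀ • ((τ₀⁻¹ * τ) • S) := mul_smul _ _ _
      _ = τ₀ • S := by rw [h]
  intro c hc
  obtain ⟨φ, rfl⟩ := oneCocycleClass_surjective
    (discreteTopRep (absoluteGaloisGroup K) (W.geomTorsion ((2 : ℕ) : ℤ))) c
  obtain ⟨Q, hQ⟩ := (oneCocycleClass_mem_resKer_iff _ _ _ φ).mp hc
  -- the local values `c τ = pointsMap (φ (resGal τ))`, `2`-torsion, `= τQ − Q`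
  set cτ : absoluteGaloisGroup E → localPoints W E :=
    fun τ ↦ pointsMap W E ((φ.1 (resGal (K := K) E τ) : W.geomTorsion ((2 : ℕ) : ℤ)) : W.geomPoints) with hcτ
  have hcQ : ∀ τ, cτ τ = τ • Q - Q := fun τ ↦ by
    rw [← hQ τ, AddMonoidHom.comp_apply, AddSubgroup.coe_subtype]
  have hc2 : ∀ τ, cτ τ + cτ τ = 0 := fun τ ↦ by
    rw [hcτ, ← two_nsmul, ← map_nsmul, ← AddSubgroupClass.coe_nsmul, AddSubgroup.torsionBy.nsmul,
      AddSubgroup.coe_zero, map_zero]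
  have hτQ : ∀ τ, τ • Q = Q + cτ τ := fun τ ↦ by rw [hcQ τ]; abel
  -- `−2Q` is `Γ_v`-fixed, hence a norm `S + τ₀S`
  have hfix : -(Q + Q) ∈ MulAction.fixedPoints (absoluteGaloisGroup E) (localPoints W E) := fun τ ↦ by
    change τ • (-(Q + Q)) = -(Q + Q)
    rw [smul_neg, smul_add, hτQ τ]
    have := hc2 τ
    rw [show Q + cτ τ + (Q + cτ τ) = Q + Q + (cτ τ + cτ τ) by abel, this, add_zero]
  obtain ⟨S, hSfix, hS⟩ := hnorm _ hfix
  have hτ₀S : τ₀ • S = -(Q + Q) - S := by rw [← hS]; abel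
  -- the bounding cochain `f = (Q + S, −(Q + S)) ∈ A_χ(K̄_v)`
  let g : ResPoints (localChar χ E) (localPoints W E) := ⟨fun i ↦ if i = 0 then Q + S else -(Q + S)⟩
  have hg : g ∈ points (localChar χ E) (localPoints W E) := by
    rw [mem_points_iff]
    change ∑ i : Fin 2, (if i = 0 then Q + S else -(Q + S)) = 0
    rw [Fin.sum_univ_two]
    simp
  have hg0 : g 0 = Q + S := by
    change (if (0 : ZMod 2) = 0 then Q + S else -(Q + S)) = Q + S
    exact if_pos rfl
  have hg1 : g 1 = -(Q + S) := by
    change (if (1 : ZMod 2) = 0 then Q + S else -(Q + S)) = -(Q + S)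
    exact if_neg (by decide)
  refine (oneCocycleClass_mem_resKer_iff _ _ _ φ).mpr ⟨⟨g, hg⟩, fun τ ↦ ?_⟩
  apply Subtype.ext
  apply PrimeTwist.ResPoints.ext
  intro i
  rw [coe_locMap_constEmb_apply, AddSubgroupClass.coe_sub, PrimeTwist.ResPoints.sub_apply, PrimeTwist.points.coe_smul,
    PrimeTwist.ResPoints.smul_apply']
  change cτ τ = τ • g (i - ResPoints.expo (localChar χ E) τ) - g i
  have h01 : ∀ z : ZMod 2, z = 0 ∨ z = 1 := by decide
  have h2 := hc2 τ
  rcases hsq τ with hτ | hτ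
  · -- `τ` fixes `α`: coordinatewise action, `τS = S`
    rw [(expo_localChar_eq_of_iff χ hχα τ).1 hτ, sub_zero]
    have hτS : τ • S = S := hSfix τ hτ
    rcases h01 i with hi | hi
    · rw [hi, hg0, smul_add, hτQ τ, hτS]
      abel
    · rw [hi, hg1, smul_neg, smul_add, hτQ τ, hτS]
      calc cτ τ = -(cτ τ) + (cτ τ + cτ τ) := by abel
        _ = -(Q + cτ τ + S) - -(Q + S) := by rw [h2]; abel
  · -- `τ` flips `α`: the coordinates are swapped, `τS = τ₀S = −2Q − S`
    have hne : (show AlgebraicClosure E ≃ₐ[E] AlgebraicClosure E from τ) α ≠ α := by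
      intro h
      haveI : CharZero E := charZero_of_injective_algebraMap (algebraMap K _).injective
      have hα0 : α ≠ 0 := by
        intro h0
        apply hd 0
        have h' := closureEmb_geomSqrt_sq_eq_algebraMap (K := K) (d := d) v
        rw [← hαdef, h0, zero_pow two_ne_zero, eq_comm, map_eq_zero] at h'
        rw [h', zero_pow two_ne_zero]
      rw [h] at hτ
      have hαα : α + α = 0 := by nth_rw 2 [hτ]; exact add_neg_cancel α
      rw [← two_mul, mul_eq_zero, or_iff_right (two_ne_zero)] at hαα
      exact hα0 hαα
    rw [(expo_localChar_eq_of_iff χ hχα τ).2 hne]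
    have hτS : τ • S = -(Q + Q) - S := (hflip τ hτ S hSfix).trans hτ₀S
    rcases h01 i with hi | hi
    · rw [hi, show (0 : ZMod 2) - 1 = 1 by decide, hg1, hg0, smul_neg, smul_add, hτQ τ, hτS]
      calc cτ τ = -(cτ τ) + (cτ τ + cτ τ) := by abel
        _ = -(Q + cτ τ + (-(Q + Q) - S)) - (Q + S) := by rw [h2]; abel
    · rw [hi, show (1 : ZMod 2) - 1 = 0 by decide, hg0, hg1, smul_add, hτQ τ, hτS]
      abel

/-- **THE INERT COMPARISON, inclusion `H¹_𝒜(K_v) ≤ H¹_f(K_v)`** — same hypotheses: a class of `H¹(K, E[2])` in the `𝔓`-Selmer local condition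
of `A_χ` at `K_v` lies in `E`'s Kummer local condition at `K_v`. If `c|_{Γ_v} = ∂f` with `f = (R, −R) ∈ A_χ(K̄_v)`, then `T = 2R` is fixed by the
stabiliser of `α` and `T + τ₀T = O`, so `T = τ₀S − S` with `S` fixed by the stabiliser (`H¹(Gal(K_v(α)/K_v), E(K_v(α))) = 0`, file 31), and
`c|_{Γ_v} = ∂(R + S)` in `E(K̄_v)`. [cite: KramerTunnell1982, §6 proof of Lemma 6.1 (p. 327)] [cite: MazurRubin2007, Def 4.3 and §5] -/
theorem primeTwist_selmerLocalKer_le_of_inert (hv : W.HasGoodReductionAt v)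
    (hα : closureEmb (K := K) (v.adicCompletion K) (geomSqrt d) ∈ maxUnramified (v.adicCompletion K))
    (hd : ∀ s : v.adicCompletion K, s ^ 2 ≠ algebraMap K (v.adicCompletion K) d)
    (hχα : ∀ τ : absoluteGaloisGroup (v.adicCompletion K), χ (resGal (K := K) (v.adicCompletion K) τ) = 1 ↔
      (show AlgebraicClosure (v.adicCompletion K) ≃ₐ[v.adicCompletion K] AlgebraicClosure (v.adicCompletion K) from τ)
        (closureEmb (K := K) (v.adicCompletion K) (geomSqrt d)) = closureEmb (K := K) (v.adicCompletion K) (geomSqrt d)) :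
    PrimeTwist.selmerLocalKer W χ (v.adicCompletion K) ≤ W.selmerLocalKer (v.adicCompletion K) 2 := by
  set E := v.adicCompletion K with hEdef
  set α := closureEmb (K := K) E (geomSqrt d) with hαdef
  obtain ⟨τ₀, hτ₀⟩ := exists_flip_closureEmb_geomSqrt v hd
  have hanti := forall_exists_sub_of_hasGoodReductionAt_of_mem_maxUnramified W v hv hα hd hτ₀
  have hsq : ∀ τ : absoluteGaloisGroup E,
      (show AlgebraicClosure E ≃ₐ[E] AlgebraicClosure E from τ) α = α ∨
        (show AlgebraicClosure E ≃ₐ[E] AlgebraicClosure E from τ) α = -α := fun τ ↦ by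
    have h2 : ((show AlgebraicClosure E ≃ₐ[E] AlgebraicClosure E from τ) α) ^ 2 = α ^ 2 := by
      rw [← map_pow, hαdef, closureEmb_geomSqrt_sq_eq_algebraMap v, AlgEquiv.commutes]
    exact sq_eq_sq_iff_eq_or_eq_neg.mp h2
  haveI : CharZero E := charZero_of_injective_algebraMap (algebraMap K _).injective
  have hα0 : α ≠ 0 := by
    intro h0
    apply hd 0
    have h' := closureEmb_geomSqrt_sq_eq_algebraMap (K := K) (d := d) v
    rw [← hαdef, h0, zero_pow two_ne_zero, eq_comm, map_eq_zero] at h'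
    rw [h', zero_pow two_ne_zero]
  have hne_of_flip : ∀ τ : absoluteGaloisGroup E, (show AlgebraicClosure E ≃ₐ[E] AlgebraicClosure E from τ) α = -α →
      (show AlgebraicClosure E ≃ₐ[E] AlgebraicClosure E from τ) α ≠ α := by
    intro τ hτ h
    rw [h] at hτ
    have h2 : α + α = 0 := by nth_rw 2 [hτ]; exact add_neg_cancel α
    rw [← two_mul, mul_eq_zero, or_iff_right (two_ne_zero)] at h2
    exact hα0 h2
  have hflip : ∀ τ : absoluteGaloisGroup E, (show AlgebraicClosure E ≃ₐ[E] AlgebraicClosure E from τ) α = -α →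
      ∀ S : localPoints W E, (∀ g : absoluteGaloisGroup E,
        (show AlgebraicClosure E ≃ₐ[E] AlgebraicClosure E from g) α = α → g • S = S) → τ • S = τ₀ • S := by
    intro τ hτ S hS
    have hg : (show AlgebraicClosure E ≃ₐ[E] AlgebraicClosure E from τ₀⁻¹ * τ) α = α := by
      change (show AlgebraicClosure E ≃ₐ[E] AlgebraicClosure E from τ₀⁻¹)
        ((show AlgebraicClosure E ≃ₐ[E] AlgebraicClosure E from τ) α) = α
      rw [hτ, map_neg]
      have h0 : (show AlgebraicClosure E ≃ₐ[E] AlgebraicClosure E from τ₀⁻¹)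
          ((show AlgebraicClosure E ≃ₐ[E] AlgebraicClosure E from τ₀) α) = α := by
        change (show AlgebraicClosure E ≃ₐ[E] AlgebraicClosure E from τ₀⁻¹ * τ₀) α = α
        rw [inv_mul_cancel]; rfl
      rw [hτ₀, map_neg] at h0
      rw [← neg_eq_iff_eq_neg.mpr h0.symm, neg_neg]
    have h := hS (τ₀⁻¹ * τ) hg
    calc τ • S = (τ₀ * (τ₀⁻¹ * τ)) • S := by rw [mul_inv_cancel_left]
      _ = τ₀ • ((τ₀⁻¹ * τ) • S) := mul_smul _ _ _
      _ = τ₀ • S := by rw [h]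
  intro c hc
  obtain ⟨φ, rfl⟩ := oneCocycleClass_surjective
    (discreteTopRep (absoluteGaloisGroup K) (W.geomTorsion ((2 : ℕ) : ℤ))) c
  obtain ⟨f, hf⟩ := (oneCocycleClass_mem_resKer_iff _ _ _ φ).mp hc
  set cτ : absoluteGaloisGroup E → localPoints W E :=
    fun τ ↦ pointsMap W E ((φ.1 (resGal (K := K) E τ) : W.geomTorsion ((2 : ℕ) : ℤ)) : W.geomPoints) with hcτ
  have hc2 : ∀ τ, cτ τ + cτ τ = 0 := fun τ ↦ by
    rw [hcτ, ← two_nsmul, ← map_nsmul, ← AddSubgroupClass.coe_nsmul, AddSubgroup.torsionBy.nsmul,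
      AddSubgroup.coe_zero, map_zero]
  -- `R = f 0`, `f 1 = −R`, and the coordinate-`0` equations
  set R : localPoints W E := (f : ResPoints (localChar χ E) (localPoints W E)) 0 with hRdef
  have hR1 : (f : ResPoints (localChar χ E) (localPoints W E)) 1 = -R := by
    have h := (mem_points_iff (localChar χ E) (localPoints W E) _).mp f.2
    change ∑ i : Fin 2, (f : ResPoints (localChar χ E) (localPoints W E)) i = 0 at h
    rw [Fin.sum_univ_two] at h
    exact eq_neg_of_add_eq_zero_right h
  have hcoord : ∀ τ, cτ τ = τ • (f : ResPoints (localChar χ E) (localPoints W E)) (0 - ResPoints.expo (localChar χ E) τ) - R := by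
    intro τ
    have h := congrArg (fun g : localModule W χ E ↦ (g : ResPoints (localChar χ E) (localPoints W E)) 0) (hf τ)
    simp only at h
    rw [coe_locMap_constEmb_apply, AddSubgroupClass.coe_sub, PrimeTwist.ResPoints.sub_apply, PrimeTwist.points.coe_smul,
      PrimeTwist.ResPoints.smul_apply'] at h
    exact h
  have hfixR : ∀ τ : absoluteGaloisGroup E, (show AlgebraicClosure E ≃ₐ[E] AlgebraicClosure E from τ) α = α → cτ τ = τ • R - R := by
    intro τ hτ
    rw [hcoord τ, (expo_localChar_eq_of_iff χ hχα τ).1 hτ, sub_zero]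
  have hflipR : ∀ τ : absoluteGaloisGroup E, (show AlgebraicClosure E ≃ₐ[E] AlgebraicClosure E from τ) α = -α → cτ τ = -(τ • R) - R := by
    intro τ hτ
    rw [hcoord τ, (expo_localChar_eq_of_iff χ hχα τ).2 (hne_of_flip τ hτ), show (0 : ZMod 2) - 1 = 1 by decide, hR1, smul_neg]
  -- `T = 2R` is fixed by the stabiliser of `α` and anti-fixed by `τ₀`
  have hTfix : ∀ g : absoluteGaloisGroup E, (show AlgebraicClosure E ≃ₐ[E] AlgebraicClosure E from g) α = α → g • (R + R) = R + R := by
    intro g hg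
    have h := hfixR g hg
    have h' : g • R = R + cτ g := by rw [h]; abel
    rw [smul_add, h', show R + cτ g + (R + cτ g) = R + R + (cτ g + cτ g) by abel, hc2 g, add_zero]
  have hT : R + R + τ₀ • (R + R) = 0 := by
    have h := hflipR τ₀ hτ₀
    have h' : τ₀ • R = -R - cτ τ₀ := by rw [h]; abel
    rw [smul_add, h', show R + R + (-R - cτ τ₀ + (-R - cτ τ₀)) = -(cτ τ₀ + cτ τ₀) by abel, hc2 τ₀, neg_zero]
  obtain ⟨S, hSfix, hS⟩ := hanti (R + R) hTfix hT
  have hτ₀S : τ₀ • S = S + (R + R) := by rw [← hS]; abel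
  refine (oneCocycleClass_mem_resKer_iff _ _ _ φ).mpr ⟨R + S, fun τ ↦ ?_⟩
  rw [AddMonoidHom.comp_apply, AddSubgroup.coe_subtype]
  change cτ τ = τ • (R + S) - (R + S)
  rcases hsq τ with hτ | hτ
  · rw [hfixR τ hτ, smul_add, hSfix τ hτ]; abel
  · have h := hflipR τ hτ
    have hτS : τ • S = S + (R + R) := (hflip τ hτ S hSfix).trans hτ₀S
    have h2 := hc2 τ
    -- `c = −τR − R`, so `τR + R = −c = c`
    calc cτ τ = -(cτ τ) + (cτ τ + cτ τ) := by abel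
      _ = -(-(τ • R) - R) + 0 := by rw [h2, h]
      _ = τ • (R + S) - (R + S) := by rw [smul_add, hτS]; abel

/-- **THE INERT BRICK: `H¹_𝒜(K_v, E[2]) = H¹_f(K_v, E[2])` at a place of good reduction where `χ` cuts out the unramified quadratic extension**
(`α = ι√d ∈ K_v^{nr} ∖ K_v`, `χ|_{Γ_v}` the character of `K_v(α)`): Mazur–Rubin 2010 Lemma 2.10 (v) / 2007 §5 in prime-twist currency, `p = 2`.
[cite: MazurRubin2010, Lemma 2.10 (v)] [cite: MazurRubin2007, Def 4.3, Cor 4.6 and §5] [cite: KramerTunnell1982, §6 Lemma 6.1] -/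
theorem primeTwist_selmerLocalKer_eq_of_inert (hv : W.HasGoodReductionAt v)
    (hα : closureEmb (K := K) (v.adicCompletion K) (geomSqrt d) ∈ maxUnramified (v.adicCompletion K))
    (hd : ∀ s : v.adicCompletion K, s ^ 2 ≠ algebraMap K (v.adicCompletion K) d)
    (hχα : ∀ τ : absoluteGaloisGroup (v.adicCompletion K), χ (resGal (K := K) (v.adicCompletion K) τ) = 1 ↔
      (show AlgebraicClosure (v.adicCompletion K) ≃ₐ[v.adicCompletion K] AlgebraicClosure (v.adicCompletion K) from τ)
        (closureEmb (K := K) (v.adicCompletion K) (geomSqrt d)) = closureEmb (K := K) (v.adicCompletion K) (geomSqrt d)) :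
    PrimeTwist.selmerLocalKer W χ (v.adicCompletion K) = W.selmerLocalKer (v.adicCompletion K) 2 :=
  le_antisymm (primeTwist_selmerLocalKer_le_of_inert W v χ hv hα hd hχα) (le_primeTwist_selmerLocalKer_of_inert W v χ hv hα hd hχα)

end Inert

end Summit.BirchSwinnertonDyer.BirchSwinnertonDyer.Theorems.GenusKolyArch

end
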